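import Mathlib
import Literature.Analysis.Fourier.HilbertTransformLineWeightedL2
import HarnessLib

/-!
# The `L²` isometry of the line Hilbert transform without the `L¹` hypothesis

`Literature/Analysis/Fourier`. `HilbertTransformLineL2.lean` proves `‖Hf‖₂ = ‖f‖₂` for `f ∈ L¹ ∩ L²` (the class on
which the Fourier-multiplier proof runs). Here the `L¹` hypothesis is removed by truncation IN SPACE: for a real
`g ∈ L²(ℝ)` whose symmetric p.v. integrand `t ↦ (g(x−t) − g(x+t))/t` is integrable on `(0,∞)` at EVERY `x`, the
compactly supported truncations `g_j = 𝟙_{[−j,j]}·g ∈ L¹ ∩ L²` satisfy the hypotheses of the `L¹ ∩ L²` theorem,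
`H g_j (x) → H g (x)` at every `x` (Cauchy–Schwarz on the tail `t ≥ j − |x|`), and `(H g_j)` is Cauchy in `L²`
(isometry on differences); Fatou identifies the limit:

* `eLpNorm_hilbertTransform_eq_of_memLp` — `Hg ∈ L²` and `‖Hg‖_{L²} = ‖g‖_{L²}` [cite: Grafakos2014, eq. (5.1.14)];
* `integral_weight_mul_hilbertTransform_sq_eq_of_memLp` — the weighted isometry `∫(c+x²)(Hf)² = ∫(c+x²)f²` for ODD
  `f ∈ L¹ ∩ L²` with `x·f ∈ L²` only (no `x·f ∈ L¹`), i.e. for every odd `f ∈ L¹` with `f ∈ L²((c+ξ²)dξ)` and everywhere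
  integrable p.v. integrand [cite: Grafakos2014, eq. (5.1.14)] [cite: King2009HilbertTransforms2, eq. (19.151)].

MOTIVATION (cell ns-blowup, zone Z3, case Z3-SR-CERT): the certificate space `E = odd H¹_{L²+ξ²}` lies in `L¹ ∩ L²_w` but
NOT in `{ξf ∈ L¹}`; this file is the density step that makes frame identity (E4)/(1b) «‖Hφ‖_w = ‖φ‖_w for odd φ ∈ E» a
kernel statement on all of `E` (given the two elementary embedding remarks `E ⊂ L¹`, p.v. integrability everywhere for
`H¹` functions). No definitions. WHAT THIS IS NOT: not Navier–Stokes.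
-/

namespace Literature.Analysis.Fourier

open _root_.MeasureTheory Set Filter
open scoped Real Topology ENNReal

/-! ### Plumbing: Fatou / `L²`-limit lemmas (real-valued versions of the private lemmas of `HilbertTransformLineL2`) -/

/-- If `u n → v` a.e., `∫ ‖u n − u m‖ₑ² ≤ 2aₙ + 2aₘ` and `aₙ → 0`, then `∫ ‖u n − v‖ₑ² → 0` (Fatou in `m`). [folklore] -/
private theorem tendsto_lintegral_sub_sq_of_cauchy' {u : ℕ → ℝ → ℝ} {v : ℝ → ℝ} {a : ℕ → ℝ≥0∞}
    (hu : ∀ n, AEStronglyMeasurable (u n) volume)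
    (hlim : ∀ᵐ x : ℝ, Tendsto (fun n => u n x) atTop (𝓝 (v x)))
    (hcau : ∀ n m, (∫⁻ x, ‖u n x - u m x‖ₑ ^ 2) ≤ 2 * a n + 2 * a m)
    (ha : Tendsto a atTop (𝓝 0)) :
    Tendsto (fun n => ∫⁻ x, ‖u n x - v x‖ₑ ^ 2) atTop (𝓝 0) := by
  have h2a : Tendsto (fun n => 2 * a n) atTop (𝓝 0) := by
    simpa using ENNReal.Tendsto.const_mul ha (Or.inr ENNReal.ofNat_ne_top)
  refine tendsto_of_tendsto_of_tendsto_of_le_of_le tendsto_const_nhds h2a (fun _ => zero_le) ?_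
  intro n
  show (∫⁻ x, ‖u n x - v x‖ₑ ^ 2) ≤ 2 * a n
  have hpt : ∀ᵐ x : ℝ, liminf (fun m => ‖u n x - u m x‖ₑ ^ 2) atTop = ‖u n x - v x‖ₑ ^ 2 := by
    filter_upwards [hlim] with x hx
    refine Tendsto.liminf_eq ?_
    exact ENNReal.Tendsto.pow (tendsto_const_nhds.sub hx).enorm
  have hF : (∫⁻ x, ‖u n x - v x‖ₑ ^ 2) = ∫⁻ x, liminf (fun m => ‖u n x - u m x‖ₑ ^ 2) atTop :=
    lintegral_congr_ae (by filter_upwards [hpt] with x hx; exact hx.symm)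
  rw [hF]
  refine (lintegral_liminf_le' fun m => (((hu n).sub (hu m)).enorm.pow_const 2)).trans ?_
  have hlim2 : Tendsto (fun m => 2 * a n + 2 * a m) atTop (𝓝 (2 * a n)) := by
    simpa using (tendsto_const_nhds (x := 2 * a n)).add h2a
  rw [← hlim2.liminf_eq]
  exact liminf_le_liminf (Eventually.of_forall fun m => hcau n m)

/-- `eLpNorm f 2 = (∫ ‖f‖ₑ²)^{1/2}`. [folklore] -/
private theorem eLpNorm_two_eq' (f : ℝ → ℝ) : eLpNorm f 2 volume = (∫⁻ x, ‖f x‖ₑ ^ 2) ^ (1 / (2 : ℝ)) := by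
  rw [eLpNorm_eq_lintegral_rpow_enorm_toReal two_ne_zero ENNReal.ofNat_ne_top]
  simp only [ENNReal.toReal_ofNat, ENNReal.rpow_two]

/-- From `∫ ‖u n − v‖ₑ² → 0`: `‖u n − v‖_{L²} → 0`. [folklore] -/
private theorem tendsto_eLpNorm_sub_of_lintegral' {u : ℕ → ℝ → ℝ} {v : ℝ → ℝ}
    (h : Tendsto (fun n => ∫⁻ x, ‖u n x - v x‖ₑ ^ 2) atTop (𝓝 0)) :
    Tendsto (fun n => eLpNorm (fun x => u n x - v x) 2 volume) atTop (𝓝 0) := by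
  simp_rw [eLpNorm_two_eq']
  have h0 : (0 : ℝ≥0∞) ^ (1 / (2 : ℝ)) = 0 := ENNReal.zero_rpow_of_pos (by norm_num)
  rw [← h0]
  exact (ENNReal.continuous_rpow_const.tendsto 0).comp h

/-- If `‖u n − v‖_{L²} → 0` with `v ∈ L²`, then `‖u n‖_{L²} → ‖v‖_{L²}`. [folklore] -/
private theorem tendsto_eLpNorm_of_tendsto_sub' {u : ℕ → ℝ → ℝ} {v : ℝ → ℝ}
    (hu : ∀ n, AEStronglyMeasurable (u n) volume) (hv : AEStronglyMeasurable v volume)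
    (hvfin : eLpNorm v 2 volume ≠ ⊤)
    (h : Tendsto (fun n => eLpNorm (fun x => u n x - v x) 2 volume) atTop (𝓝 0)) :
    Tendsto (fun n => eLpNorm (u n) 2 volume) atTop (𝓝 (eLpNorm v 2 volume)) := by
  have h12 : (1 : ℝ≥0∞) ≤ 2 := by norm_num
  have hup : ∀ n, eLpNorm (u n) 2 volume ≤ eLpNorm v 2 volume + eLpNorm (fun x => u n x - v x) 2 volume := by
    intro n
    have : u n = fun x => v x + (u n x - v x) := by funext x; ring
    calc eLpNorm (u n) 2 volume = eLpNorm (fun x => v x + (u n x - v x)) 2 volume := by rw [← this]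
      _ ≤ eLpNorm v 2 volume + eLpNorm (fun x => u n x - v x) 2 volume :=
          eLpNorm_add_le hv ((hu n).sub hv) h12
  have hlow : ∀ n, eLpNorm v 2 volume ≤ eLpNorm (u n) 2 volume + eLpNorm (fun x => u n x - v x) 2 volume := by
    intro n
    have : v = fun x => u n x + (-(u n x - v x)) := by funext x; ring
    calc eLpNorm v 2 volume = eLpNorm (fun x => u n x + (-(u n x - v x))) 2 volume := by rw [← this]
      _ ≤ eLpNorm (u n) 2 volume + eLpNorm (fun x => -(u n x - v x)) 2 volume :=
          eLpNorm_add_le (hu n) ((hu n).sub hv).neg h12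
      _ = eLpNorm (u n) 2 volume + eLpNorm (fun x => u n x - v x) 2 volume := by
          congr 1
          have hneg : (fun x => -(u n x - v x)) = -(fun x => u n x - v x) := rfl
          rw [hneg, eLpNorm_neg]
  refine tendsto_of_tendsto_of_tendsto_of_le_of_le (g := fun n => eLpNorm v 2 volume -
      eLpNorm (fun x => u n x - v x) 2 volume) (h := fun n => eLpNorm v 2 volume +
      eLpNorm (fun x => u n x - v x) 2 volume) ?_ ?_ (fun n => tsub_le_iff_right.2 (hlow n)) hup
  · have := ENNReal.Tendsto.sub (tendsto_const_nhds (x := eLpNorm v 2 volume)) h (Or.inl hvfin)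
    simpa using this
  · simpa using (tendsto_const_nhds (x := eLpNorm v 2 volume)).add h

/-! ### The spatial truncations `g_j = 𝟙_{[−j,j]} g` -/

/-- `g_j ∈ L¹` for `g ∈ L²`. [folklore] -/
private theorem integrable_trunc {g : ℝ → ℝ} (hg2 : MemLp g 2) (j : ℕ) :
    Integrable ((Icc (-(j : ℝ)) j).indicator g) := by
  rw [integrable_indicator_iff measurableSet_Icc]
  haveI : IsFiniteMeasure (volume.restrict (Icc (-(j : ℝ)) j)) := ⟨by
    rw [Measure.restrict_apply_univ]; exact measure_Icc_lt_top⟩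
  exact (hg2.restrict (Icc (-(j : ℝ)) j)).integrable one_le_two

/-- `g_j ∈ L²`. [folklore] -/
private theorem memLp_trunc {g : ℝ → ℝ} (hg2 : MemLp g 2) (j : ℕ) :
    MemLp ((Icc (-(j : ℝ)) j).indicator g) 2 :=
  hg2.indicator measurableSet_Icc

/-- Off the two points `|x| = j`, the truncation agrees with `g` (if `|x| < j`) or with `0` (if `|x| > j`) on the
whole window `t ∈ (0, d)`, `d = | |x| − j |`: the p.v. integrand of `g_j` there is `𝟙_{|x|<j}` times that of `g`.
[folklore] -/
private theorem trunc_symm_eq {g : ℝ → ℝ} {x : ℝ} {j : ℕ} {t : ℝ} (ht : 0 < t) (htd : t < |(|x| - (j : ℝ))|) :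
    (Icc (-(j : ℝ)) j).indicator g (x - t) - (Icc (-(j : ℝ)) j).indicator g (x + t) =
      (if |x| < (j : ℝ) then g (x - t) - g (x + t) else 0) := by
  by_cases hx : |x| < (j : ℝ)
  · -- both points inside
    rw [if_pos hx]
    have hd : t < (j : ℝ) - |x| := by rwa [abs_sub_comm, abs_of_pos (sub_pos.2 hx)] at htd
    have h1 : x - t ∈ Icc (-(j : ℝ)) j := by
      constructor <;> linarith [neg_abs_le x, le_abs_self x]
    have h2 : x + t ∈ Icc (-(j : ℝ)) j := by
      constructor <;> linarith [neg_abs_le x, le_abs_self x]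
    rw [indicator_of_mem h1, indicator_of_mem h2]
  · rw [if_neg hx]
    push Not at hx
    rcases hx.lt_or_eq with hx | hx
    · -- both points outside
      have hd : t < |x| - (j : ℝ) := by rwa [abs_of_pos (sub_pos.2 hx)] at htd
      have h1 : x - t ∉ Icc (-(j : ℝ)) j := by
        intro h
        rcases le_or_gt 0 x with hx0 | hx0
        · rw [abs_of_nonneg hx0] at hd; linarith [h.2]
        · rw [abs_of_neg hx0] at hd; linarith [h.1]
      have h2 : x + t ∉ Icc (-(j : ℝ)) j := by
        intro h
        rcases le_or_gt 0 x with hx0 | hx0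
        · rw [abs_of_nonneg hx0] at hd; linarith [h.2]
        · rw [abs_of_neg hx0] at hd; linarith [h.1]
      rw [indicator_of_notMem h1, indicator_of_notMem h2, sub_zero]
    · exfalso; rw [← hx, sub_self, abs_zero] at htd; linarith

/-- Integrability of `t ↦ φ(x − t)/t` and `t ↦ φ(x + t)/t` on `[d, ∞)`, `d > 0`, for `φ ∈ L¹`. [folklore] -/
private theorem integrableOn_shift_div {φ : ℝ → ℝ} (hφ : Integrable φ) (x : ℝ) {d : ℝ} (hd : 0 < d) :
    IntegrableOn (fun t => (φ (x - t) - φ (x + t)) / t) (Ici d) := by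
  have hA : Integrable (fun t => φ (x - t)) := hφ.comp_sub_left x
  have hB : Integrable (fun t => φ (x + t)) := hφ.comp_add_left x
  have hAB : IntegrableOn (fun t => φ (x - t) - φ (x + t)) (Ici d) := (hA.sub hB).integrableOn
  have hbound : IntegrableOn (fun t => ‖φ (x - t) - φ (x + t)‖ / d) (Ici d) := hAB.norm.div_const d
  refine Integrable.mono' hbound ?_ ?_
  · exact (hAB.aestronglyMeasurable.mul (measurable_inv.aestronglyMeasurable.restrict)).congr
      (ae_of_all _ fun t => (div_eq_mul_inv _ _).symm)
  · rw [ae_restrict_iff' measurableSet_Ici]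
    refine ae_of_all _ fun t ht => ?_
    have ht0 : 0 < t := hd.trans_le ht
    rw [norm_div, Real.norm_eq_abs t, abs_of_pos ht0]
    exact div_le_div_of_nonneg_left (norm_nonneg _) hd ht

/-- **The truncations keep the p.v. hypothesis**: if the symmetric integrand of `g ∈ L²` is integrable on `(0,∞)` at
`x` and `|x| ≠ j`, then so is that of `g_j = 𝟙_{[−j,j]} g`. [folklore] -/
private theorem integrableOn_symmIntegrand_trunc {g : ℝ → ℝ} (hg2 : MemLp g 2) {x : ℝ} {j : ℕ}
    (hx : IntegrableOn (fun t => (g (x - t) - g (x + t)) / t) (Ioi 0)) (hxj : |x| ≠ (j : ℝ)) :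
    IntegrableOn (fun t => ((Icc (-(j : ℝ)) j).indicator g (x - t) -
      (Icc (-(j : ℝ)) j).indicator g (x + t)) / t) (Ioi 0) := by
  set d : ℝ := |(|x| - (j : ℝ))| with hd
  have hdpos : 0 < d := abs_pos.2 (sub_ne_zero.2 hxj)
  have hsplit : Ioi (0 : ℝ) = Ioo 0 d ∪ Ici d := by
    ext t; simp only [mem_Ioi, mem_union, mem_Ioo, mem_Ici]
    constructor
    · intro ht; rcases lt_or_ge t d with h | h; exacts [Or.inl ⟨ht, h⟩, Or.inr h]
    · rintro (⟨ht, _⟩ | h); exacts [ht, hdpos.trans_le h]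
  rw [hsplit]
  refine IntegrableOn.union ?_ (integrableOn_shift_div (integrable_trunc hg2 j) x hdpos)
  -- on `(0, d)` the integrand is `𝟙_{|x|<j}` times that of `g`
  have hx' : IntegrableOn (fun t => (if |x| < (j : ℝ) then g (x - t) - g (x + t) else 0) / t) (Ioo 0 d) := by
    by_cases h : |x| < (j : ℝ)
    · simp only [if_pos h]; exact hx.mono_set Ioo_subset_Ioi_self
    · simp only [if_neg h, zero_div]; exact integrableOn_zero
  refine hx'.congr_fun (fun t ht => ?_) measurableSet_Ioo
  rw [trunc_symm_eq ht.1 ht.2]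

/-- **Pointwise convergence of the truncations' transforms**, quantitative tail bound: for `g ∈ L²`, `x`, and
`j ≥ |x| + 1` (so `d = j − |x| ≥ 1`): `|Hg(x) − Hg_j(x)| ≤ π⁻¹·2‖g‖₂·d^{-1/2}`... stated as the limit. [folklore] -/
private theorem tendsto_hilbertTransform_trunc {g : ℝ → ℝ} (hg2 : MemLp g 2) {x : ℝ}
    (hx : IntegrableOn (fun t => (g (x - t) - g (x + t)) / t) (Ioi 0)) :
    Tendsto (fun j : ℕ => hilbertTransform ((Icc (-(j : ℝ)) j).indicator g) x) atTop
      (𝓝 (hilbertTransform g x)) := by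
  -- work with the complement truncation `h_j = g − g_j`, supported in `|y| > j`
  have hM : (∫⁻ y, ‖g y‖ₑ ^ 2) < ∞ := by
    have h := lintegral_rpow_enorm_lt_top_of_eLpNorm_lt_top two_ne_zero ENNReal.ofNat_ne_top
      hg2.eLpNorm_lt_top
    simpa [ENNReal.rpow_two] using h
  set M : ℝ := (∫⁻ y, ‖g y‖ₑ ^ 2).toReal with hMdef
  -- the real bound: for `j ≥ |x| + 1`, `|Hg x − Hg_j x| ≤ π⁻¹ * 2 * √M * (j − |x|)^{-1/2}`
  rw [Metric.tendsto_atTop]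
  intro δ hδ
  -- choose `J` with `π⁻¹ * 2 * √M / √(J − |x|) < δ`, i.e. `J > |x| + (2√M/(πδ))²`
  obtain ⟨J, hJ⟩ := exists_nat_gt (|x| + 1 + (2 * Real.sqrt M / (π * δ)) ^ 2)
  refine ⟨J, fun j hj => ?_⟩
  have hjx : |x| + 1 ≤ (j : ℝ) := by
    have : (J : ℝ) ≤ j := by exact_mod_cast hj
    nlinarith [sq_nonneg (2 * Real.sqrt M / (π * δ))]
  set d : ℝ := (j : ℝ) - |x| with hddef
  have hd1 : 1 ≤ d := by linarith
  have hd0 : 0 < d := by linarith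
  have hxj : |x| ≠ (j : ℝ) := by intro h; linarith
  -- `Hg x − Hg_j x = H(h_j) x` with `h_j = g − g_j`
  have hIj := integrableOn_symmIntegrand_trunc hg2 hx hxj (j := j)
  have hdiff : hilbertTransform g x - hilbertTransform ((Icc (-(j : ℝ)) j).indicator g) x =
      π⁻¹ * ∫ t in Ioi (0 : ℝ), ((g (x - t) - (Icc (-(j : ℝ)) j).indicator g (x - t)) -
        (g (x + t) - (Icc (-(j : ℝ)) j).indicator g (x + t))) / t := by
    unfold hilbertTransform
    rw [← mul_sub, ← integral_sub hx hIj]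
    congr 1
    refine integral_congr_ae (ae_of_all _ fun t => ?_)
    simp only
    ring
  -- the integrand of `h_j` vanishes for `t < d` and is bounded by `(|g(x−t)| + |g(x+t)|)/t` for `t ≥ d`
  have hvan : ∀ t ∈ Ioi (0 : ℝ), ((g (x - t) - (Icc (-(j : ℝ)) j).indicator g (x - t)) -
      (g (x + t) - (Icc (-(j : ℝ)) j).indicator g (x + t))) / t =
      (Ici d).indicator (fun t => ((g (x - t) - (Icc (-(j : ℝ)) j).indicator g (x - t)) -
        (g (x + t) - (Icc (-(j : ℝ)) j).indicator g (x + t))) / t) t := by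
    intro t ht
    by_cases htd : t ∈ Ici d
    · rw [indicator_of_mem htd]
    · rw [indicator_of_notMem htd]
      have htd' : t < d := lt_of_not_ge htd
      have hlt : |x| < (j : ℝ) := by linarith
      have htd'' : t < |(|x| - (j : ℝ))| := by
        rw [abs_sub_comm, abs_of_pos (sub_pos.2 hlt)]; exact htd'
      have h := trunc_symm_eq (g := g) ht htd''
      rw [if_pos hlt] at h
      have : (g (x - t) - (Icc (-(j : ℝ)) j).indicator g (x - t)) -
          (g (x + t) - (Icc (-(j : ℝ)) j).indicator g (x + t)) = 0 := by linarith
      rw [this, zero_div]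
  rw [Real.dist_eq, abs_sub_comm, hdiff, setIntegral_congr_fun measurableSet_Ioi hvan,
    setIntegral_indicator measurableSet_Ici, show Ioi (0 : ℝ) ∩ Ici d = Ici d from
      inter_eq_right.2 (fun t ht => hd0.trans_le ht)]
  -- bound the tail integral by Cauchy–Schwarz
  have hA2 : MemLp (fun t => g (x - t)) 2 := hg2.comp_measurePreserving (Measure.measurePreserving_sub_left volume x)
  have hB2 : MemLp (fun t => g (x + t)) 2 := hg2.comp_measurePreserving (measurePreserving_add_left volume x)
  -- `t⁻¹ ∈ L²(Ici d)` with `∫_{Ici d} t⁻² = 1/d`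
  have hinv2 : IntegrableOn (fun t : ℝ => t ^ (-2 : ℝ)) (Ici d) := by
    rw [integrableOn_Ici_iff_integrableOn_Ioi]
    exact integrableOn_Ioi_rpow_of_lt (by norm_num) hd0
  have hinvL2 : MemLp (fun t : ℝ => t⁻¹) 2 (volume.restrict (Ici d)) := by
    refine (memLp_two_iff_integrable_sq (measurable_inv.aestronglyMeasurable.restrict)).2 ?_
    refine hinv2.congr_fun (fun t ht => ?_) measurableSet_Ici
    have ht0 : 0 < t := hd0.trans_le ht
    show t ^ (-2 : ℝ) = t⁻¹ ^ 2
    rw [Real.rpow_neg ht0.le, Real.rpow_two, inv_pow]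
  have hIint : ∫ t in Ici d, (t⁻¹) ^ (2 : ℝ) = d⁻¹ := by
    have e1 : ∫ t in Ici d, (t⁻¹) ^ (2 : ℝ) = ∫ t in Ioi d, t ^ (-2 : ℝ) := by
      rw [setIntegral_congr_set Ioi_ae_eq_Ici.symm]
      refine setIntegral_congr_fun measurableSet_Ioi (fun t ht => ?_)
      have ht0 : 0 < t := hd0.trans ht
      rw [Real.rpow_neg ht0.le, Real.rpow_two, inv_pow, Real.rpow_two]
    rw [e1, integral_Ioi_rpow_of_lt (by norm_num) hd0]
    rw [show (-2 : ℝ) + 1 = -1 by norm_num, Real.rpow_neg_one]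
    ring
  -- Cauchy–Schwarz for the two shifted pieces
  have hCS : ∀ (φ : ℝ → ℝ), MemLp φ 2 → (∫⁻ y, ‖φ y‖ₑ ^ 2) = ∫⁻ y, ‖g y‖ₑ ^ 2 →
      ∫ t in Ici d, |φ t| * t⁻¹ ≤ Real.sqrt M * Real.sqrt (d⁻¹) := by
    intro φ hφ hφM
    have hφr : MemLp (fun t => |φ t|) (ENNReal.ofReal 2) (volume.restrict (Ici d)) := by
      have := (hφ.restrict (Ici d)).norm
      simpa [Real.norm_eq_abs] using this
    have hir : MemLp (fun t : ℝ => t⁻¹) (ENNReal.ofReal 2) (volume.restrict (Ici d)) := by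
      simpa using hinvL2
    have h := integral_mul_le_Lp_mul_Lq_of_nonneg Real.HolderConjugate.two_two
      (ae_of_all _ fun t => abs_nonneg (φ t))
      ((ae_restrict_iff' measurableSet_Ici).2 (ae_of_all _ fun t ht => (inv_pos.2 (hd0.trans_le ht)).le))
      hφr hir
    refine h.trans ?_
    have hφint : ∫ t in Ici d, |φ t| ^ (2 : ℝ) ≤ M := by
      have i1 : ∫ t in Ici d, |φ t| ^ (2 : ℝ) = ∫ t in Ici d, φ t ^ 2 := by
        refine integral_congr_ae (ae_of_all _ fun t => ?_); simp only [Real.rpow_two, sq_abs]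
      rw [i1]
      have i2 : ∫ t in Ici d, φ t ^ 2 ≤ ∫ t, φ t ^ 2 :=
        setIntegral_le_integral hφ.integrable_sq (ae_of_all _ fun t => sq_nonneg _)
      refine i2.trans (le_of_eq ?_)
      rw [integral_eq_lintegral_of_nonneg_ae (ae_of_all _ fun t => sq_nonneg _)
        hφ.integrable_sq.aestronglyMeasurable, hMdef, ← hφM]
      congr 1
      refine lintegral_congr fun t => ?_
      rw [← ofReal_norm, Real.norm_eq_abs, ← ENNReal.ofReal_pow (abs_nonneg _), sq_abs]
    rw [hIint]
    gcongr
    · rw [Real.sqrt_eq_rpow]; gcongr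
    · rw [Real.sqrt_eq_rpow]
  have hAint := hCS (fun t => g (x - t)) hA2 (lintegral_sub_left_eq_self (fun y => ‖g y‖ₑ ^ 2) x)
  have hBint := hCS (fun t => g (x + t)) hB2 (lintegral_add_left_eq_self (fun y => ‖g y‖ₑ ^ 2) x)
  -- pointwise bound of the tail integrand
  have hbd : ∀ t ∈ Ici d, ‖((g (x - t) - (Icc (-(j : ℝ)) j).indicator g (x - t)) -
      (g (x + t) - (Icc (-(j : ℝ)) j).indicator g (x + t))) / t‖ ≤ |g (x - t)| * t⁻¹ + |g (x + t)| * t⁻¹ := by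
    intro t ht
    have ht0 : 0 < t := hd0.trans_le ht
    have h1 : |g (x - t) - (Icc (-(j : ℝ)) j).indicator g (x - t)| ≤ |g (x - t)| := by
      by_cases hm : x - t ∈ Icc (-(j : ℝ)) j
      · rw [indicator_of_mem hm, sub_self, abs_zero]; exact abs_nonneg _
      · rw [indicator_of_notMem hm, sub_zero]
    have h2 : |g (x + t) - (Icc (-(j : ℝ)) j).indicator g (x + t)| ≤ |g (x + t)| := by
      by_cases hm : x + t ∈ Icc (-(j : ℝ)) j
      · rw [indicator_of_mem hm, sub_self, abs_zero]; exact abs_nonneg _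
      · rw [indicator_of_notMem hm, sub_zero]
    rw [Real.norm_eq_abs, abs_div, abs_of_pos ht0, div_eq_mul_inv, ← add_mul]
    gcongr
    exact (abs_sub _ _).trans (add_le_add h1 h2)
  -- integrability of the two majorants on `Ici d`
  have hmajA : IntegrableOn (fun t => |g (x - t)| * t⁻¹) (Ici d) :=
    ((hA2.restrict (Ici d)).abs).integrable_mul hinvL2
  have hmajB : IntegrableOn (fun t => |g (x + t)| * t⁻¹) (Ici d) :=
    ((hB2.restrict (Ici d)).abs).integrable_mul hinvL2
  have hnorm : ‖∫ t in Ici d, ((g (x - t) - (Icc (-(j : ℝ)) j).indicator g (x - t)) -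
      (g (x + t) - (Icc (-(j : ℝ)) j).indicator g (x + t))) / t‖ ≤
      ∫ t in Ici d, (|g (x - t)| * t⁻¹ + |g (x + t)| * t⁻¹) :=
    norm_integral_le_of_norm_le (hmajA.add hmajB) ((ae_restrict_iff' measurableSet_Ici).2 (ae_of_all _ hbd))
  rw [integral_add hmajA hmajB] at hnorm
  -- the final numeric inequality
  have hsum := add_le_add hAint hBint
  have hkey : 2 * Real.sqrt M / (π * δ) < Real.sqrt d := by
    have h1 : (2 * Real.sqrt M / (π * δ)) ^ 2 < d := by
      have : (J : ℝ) ≤ j := by exact_mod_cast hj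
      rw [hddef]; linarith
    have h0 : 0 ≤ 2 * Real.sqrt M / (π * δ) := by positivity
    calc 2 * Real.sqrt M / (π * δ) = Real.sqrt ((2 * Real.sqrt M / (π * δ)) ^ 2) := (Real.sqrt_sq h0).symm
      _ < Real.sqrt d := Real.sqrt_lt_sqrt (sq_nonneg _) h1
  have hdsqrt : 0 < Real.sqrt d := Real.sqrt_pos.2 hd0
  have hsi : Real.sqrt (d⁻¹) = (Real.sqrt d)⁻¹ := Real.sqrt_inv d
  rw [abs_mul, abs_of_pos (inv_pos.2 Real.pi_pos)]
  calc π⁻¹ * |∫ t in Ici d, ((g (x - t) - (Icc (-(j : ℝ)) j).indicator g (x - t)) -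
        (g (x + t) - (Icc (-(j : ℝ)) j).indicator g (x + t))) / t|
      ≤ π⁻¹ * (Real.sqrt M * Real.sqrt (d⁻¹) + Real.sqrt M * Real.sqrt (d⁻¹)) := by
        rw [← Real.norm_eq_abs]; gcongr; exact hnorm.trans hsum
    _ = (2 * Real.sqrt M / (π * Real.sqrt d)) := by rw [hsi]; field_simp; ring
    _ < δ := by
        rw [div_lt_iff₀ (by positivity)]
        rw [div_lt_iff₀ (by positivity)] at hkey
        nlinarith [Real.pi_pos, hdsqrt, hδ]

/-! ### The `L²` isometry without `L¹` -/

/-- **`‖Hg‖_{L²} = ‖g‖_{L²}` for `g ∈ L²`** (no `L¹` hypothesis) whose symmetric p.v. integrand is integrable on `(0,∞)` at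
every point; in particular `Hg ∈ L²`. [cite: Grafakos2014, eq. (5.1.14)] -/
theorem eLpNorm_hilbertTransform_eq_of_memLp {g : ℝ → ℝ} (hg2 : MemLp g 2)
    (hint : ∀ x : ℝ, IntegrableOn (fun t => (g (x - t) - g (x + t)) / t) (Ioi 0)) :
    MemLp (hilbertTransform g) 2 ∧ eLpNorm (hilbertTransform g) 2 volume = eLpNorm g 2 volume := by
  -- truncations `u j = H g_j`, their a.e. p.v. hypothesis, integrability, `L²`
  have hI : ∀ j : ℕ, Integrable ((Icc (-(j : ℝ)) j).indicator g) := integrable_trunc hg2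
  have hM2 : ∀ j : ℕ, MemLp ((Icc (-(j : ℝ)) j).indicator g) 2 := memLp_trunc hg2
  have hae : ∀ j : ℕ, ∀ᵐ x : ℝ, IntegrableOn (fun t => ((Icc (-(j : ℝ)) j).indicator g (x - t) -
      (Icc (-(j : ℝ)) j).indicator g (x + t)) / t) (Ioi 0) := by
    intro j
    have hnull : (volume : Measure ℝ) {x | |x| = (j : ℝ)} = 0 := by
      have hsub : {x : ℝ | |x| = (j : ℝ)} ⊆ {(j : ℝ), -(j : ℝ)} := by
        intro x hx
        simp only [mem_setOf_eq] at hx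
        rcases abs_eq (Nat.cast_nonneg j) |>.1 hx with h | h
        · exact Or.inl h
        · exact Or.inr h
      exact measure_mono_null hsub (((Set.finite_singleton (-(j : ℝ))).insert (j : ℝ)).measure_zero volume)
    filter_upwards [compl_mem_ae_iff.mpr hnull] with x hx
    exact integrableOn_symmIntegrand_trunc hg2 (hint x) hx
  have hH := fun j : ℕ => memLp_two_hilbertTransform_and_eLpNorm_eq (hI j) (hM2 j) (hae j)
  have hu : ∀ j : ℕ, AEStronglyMeasurable (hilbertTransform ((Icc (-(j : ℝ)) j).indicator g)) volume :=
    fun j => (hH j).1.1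
  -- pointwise convergence everywhere
  have hlim : ∀ᵐ x : ℝ, Tendsto (fun j : ℕ => hilbertTransform ((Icc (-(j : ℝ)) j).indicator g) x) atTop
      (𝓝 (hilbertTransform g x)) := ae_of_all _ fun x => tendsto_hilbertTransform_trunc hg2 (hint x)
  have hv : AEStronglyMeasurable (hilbertTransform g) volume := aestronglyMeasurable_of_tendsto_ae atTop hu hlim
  -- `a j := ∫ ‖g_j − g‖ₑ² → 0` (dominated convergence)
  have ha : Tendsto (fun j : ℕ => ∫⁻ x, ‖(Icc (-(j : ℝ)) j).indicator g x - g x‖ₑ ^ 2) atTop (𝓝 0) := by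
    have hM : (∫⁻ y, ‖g y‖ₑ ^ 2) < ∞ := by
      have h := lintegral_rpow_enorm_lt_top_of_eLpNorm_lt_top two_ne_zero ENNReal.ofNat_ne_top
        hg2.eLpNorm_lt_top
      simpa [ENNReal.rpow_two] using h
    have h := tendsto_lintegral_of_dominated_convergence' (μ := volume)
      (F := fun (j : ℕ) x => ‖(Icc (-(j : ℝ)) j).indicator g x - g x‖ₑ ^ 2) (f := fun _ => 0)
      (fun x => ‖g x‖ₑ ^ 2) (fun j => (((hM2 j).1.sub hg2.1).enorm.pow_const 2)) (fun j => ae_of_all _ fun x => ?_)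
      hM.ne (ae_of_all _ fun x => ?_)
    · simpa using h
    · -- `|g_j − g| ≤ |g|` pointwise
      show ‖(Icc (-(j : ℝ)) j).indicator g x - g x‖ₑ ^ 2 ≤ ‖g x‖ₑ ^ 2
      gcongr ?_ ^ 2
      by_cases hx : x ∈ Icc (-(j : ℝ)) j
      · rw [indicator_of_mem hx, sub_self, enorm_zero]; exact zero_le
      · rw [indicator_of_notMem hx, zero_sub, enorm_neg]
    · -- eventually `g_j x = g x`
      show Tendsto (fun n : ℕ => ‖(Icc (-(n : ℝ)) n).indicator g x - g x‖ₑ ^ 2) atTop (𝓝 0)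
      obtain ⟨J, hJ⟩ := exists_nat_gt |x|
      refine tendsto_atTop_of_eventually_const (i₀ := J) fun j hj => ?_
      have hxj : x ∈ Icc (-(j : ℝ)) j := by
        have : (J : ℝ) ≤ j := by exact_mod_cast hj
        constructor <;> linarith [neg_abs_le x, le_abs_self x, hJ.trans_le this]
      rw [indicator_of_mem hxj, sub_self, enorm_zero, zero_pow two_ne_zero]
  -- Cauchy bound: `∫ ‖Hg_j − Hg_i‖ₑ² = ∫ ‖g_j − g_i‖ₑ² ≤ 2 a_j + 2 a_i`
  have hcau : ∀ j i : ℕ, (∫⁻ x, ‖hilbertTransform ((Icc (-(j : ℝ)) j).indicator g) x -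
      hilbertTransform ((Icc (-(i : ℝ)) i).indicator g) x‖ₑ ^ 2) ≤
      2 * (∫⁻ x, ‖(Icc (-(j : ℝ)) j).indicator g x - g x‖ₑ ^ 2) +
      2 * (∫⁻ x, ‖(Icc (-(i : ℝ)) i).indicator g x - g x‖ₑ ^ 2) := by
    intro j i
    -- the difference `g_j − g_i` is in `L¹ ∩ L²` with a.e. p.v. hypothesis, and `H(g_j − g_i) = Hg_j − Hg_i` a.e.
    have hId : Integrable (fun y => (Icc (-(j : ℝ)) j).indicator g y - (Icc (-(i : ℝ)) i).indicator g y) :=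
      (hI j).sub (hI i)
    have hMd : MemLp (fun y => (Icc (-(j : ℝ)) j).indicator g y - (Icc (-(i : ℝ)) i).indicator g y) 2 :=
      (hM2 j).sub (hM2 i)
    have haed : ∀ᵐ x : ℝ, IntegrableOn (fun t => (((Icc (-(j : ℝ)) j).indicator g (x - t) -
        (Icc (-(i : ℝ)) i).indicator g (x - t)) - ((Icc (-(j : ℝ)) j).indicator g (x + t) -
        (Icc (-(i : ℝ)) i).indicator g (x + t))) / t) (Ioi 0) := by
      filter_upwards [hae j, hae i] with x hxj hxi
      refine (hxj.sub hxi).congr_fun (fun t _ => ?_) measurableSet_Ioi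
      simp only [Pi.sub_apply]; ring
    have hiso := integral_hilbertTransform_sq_eq hId hMd haed
    -- `H(g_j − g_i) = Hg_j − Hg_i` where both integrands converge
    have hlin : ∀ᵐ x : ℝ, hilbertTransform (fun y => (Icc (-(j : ℝ)) j).indicator g y -
        (Icc (-(i : ℝ)) i).indicator g y) x = hilbertTransform ((Icc (-(j : ℝ)) j).indicator g) x -
        hilbertTransform ((Icc (-(i : ℝ)) i).indicator g) x := by
      filter_upwards [hae j, hae i] with x hxj hxi
      have hneg : IntegrableOn (fun t => ((fun y => -(Icc (-(i : ℝ)) i).indicator g y) (x - t) -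
          (fun y => -(Icc (-(i : ℝ)) i).indicator g y) (x + t)) / t) (Ioi 0) := by
        refine (hxi.neg).congr_fun (fun t _ => ?_) measurableSet_Ioi
        simp only [Pi.neg_apply]; ring
      have h := hilbertTransform_add (f := (Icc (-(j : ℝ)) j).indicator g)
        (g := fun y => -(Icc (-(i : ℝ)) i).indicator g y) hxj hneg
      have e1 : (fun y => (Icc (-(j : ℝ)) j).indicator g y + -(Icc (-(i : ℝ)) i).indicator g y) =
          fun y => (Icc (-(j : ℝ)) j).indicator g y - (Icc (-(i : ℝ)) i).indicator g y := by
        funext y; ring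
      have e2 : hilbertTransform (fun y => -(Icc (-(i : ℝ)) i).indicator g y) x =
          -hilbertTransform ((Icc (-(i : ℝ)) i).indicator g) x := hilbertTransform_neg _ x
      rw [e1, e2] at h
      rw [h]; ring
    -- convert the real integrals of squares to lintegrals
    have hsqH : Integrable (fun x => (hilbertTransform (fun y => (Icc (-(j : ℝ)) j).indicator g y -
        (Icc (-(i : ℝ)) i).indicator g y) x) ^ 2) := (memLp_two_hilbertTransform hId hMd haed).integrable_sq
    have e : ∀ (φ : ℝ → ℝ), Integrable (fun x => φ x ^ 2) → ENNReal.ofReal (∫ x, φ x ^ 2) = ∫⁻ x, ‖φ x‖ₑ ^ 2 := by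
      intro φ hφ
      rw [ofReal_integral_eq_lintegral_ofReal hφ (ae_of_all _ fun x => sq_nonneg _)]
      refine lintegral_congr fun x => ?_
      rw [← ofReal_norm, Real.norm_eq_abs, ← ENNReal.ofReal_pow (abs_nonneg _), sq_abs]
    have hL : (∫⁻ x, ‖hilbertTransform ((Icc (-(j : ℝ)) j).indicator g) x -
        hilbertTransform ((Icc (-(i : ℝ)) i).indicator g) x‖ₑ ^ 2) =
        ∫⁻ x, ‖(Icc (-(j : ℝ)) j).indicator g x - (Icc (-(i : ℝ)) i).indicator g x‖ₑ ^ 2 := by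
      rw [← e _ hMd.integrable_sq, ← hiso, e _ hsqH]
      exact lintegral_congr_ae (by filter_upwards [hlin] with x hx; rw [hx])
    rw [hL]
    -- `‖g_j − g_i‖ₑ² ≤ 2‖g_j − g‖ₑ² + 2‖g_i − g‖ₑ²` pointwise, then integrate
    have hmeas : ∀ k : ℕ, AEMeasurable (fun x => ‖(Icc (-(k : ℝ)) k).indicator g x - g x‖ₑ ^ 2) volume :=
      fun k => ((hM2 k).1.sub hg2.1).enorm.pow_const 2
    calc (∫⁻ x, ‖(Icc (-(j : ℝ)) j).indicator g x - (Icc (-(i : ℝ)) i).indicator g x‖ₑ ^ 2)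
        ≤ ∫⁻ x, (2 * ‖(Icc (-(j : ℝ)) j).indicator g x - g x‖ₑ ^ 2 +
            2 * ‖(Icc (-(i : ℝ)) i).indicator g x - g x‖ₑ ^ 2) := by
          refine lintegral_mono fun x => ?_
          have e3 : ‖(Icc (-(j : ℝ)) j).indicator g x - (Icc (-(i : ℝ)) i).indicator g x‖ₑ ^ 2 =
              ENNReal.ofReal (((Icc (-(j : ℝ)) j).indicator g x - (Icc (-(i : ℝ)) i).indicator g x) ^ 2) := by
            rw [← ofReal_norm, Real.norm_eq_abs, ← ENNReal.ofReal_pow (abs_nonneg _), sq_abs]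
          have e4 : ∀ r : ℝ, 2 * ‖r‖ₑ ^ 2 = ENNReal.ofReal (2 * r ^ 2) := fun r => by
            rw [← ofReal_norm, Real.norm_eq_abs, ← ENNReal.ofReal_pow (abs_nonneg _), sq_abs,
              ENNReal.ofReal_mul (by norm_num), ENNReal.ofReal_ofNat]
          rw [e3, e4, e4, ← ENNReal.ofReal_add (by positivity) (by positivity)]
          refine ENNReal.ofReal_le_ofReal ?_
          nlinarith [sq_nonneg ((Icc (-(j : ℝ)) j).indicator g x - g x + ((Icc (-(i : ℝ)) i).indicator g x - g x))]
      _ = 2 * (∫⁻ x, ‖(Icc (-(j : ℝ)) j).indicator g x - g x‖ₑ ^ 2) +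
            2 * (∫⁻ x, ‖(Icc (-(i : ℝ)) i).indicator g x - g x‖ₑ ^ 2) := by
          rw [lintegral_add_left' ((hmeas j).const_mul 2), lintegral_const_mul'' _ (hmeas j),
            lintegral_const_mul'' _ (hmeas i)]
  -- `L²` convergence of the transforms and of the truncations themselves
  have hD := tendsto_lintegral_sub_sq_of_cauchy' hu hlim hcau ha
  have hT := tendsto_eLpNorm_sub_of_lintegral' hD
  have hTg : Tendsto (fun j : ℕ => eLpNorm (fun x => (Icc (-(j : ℝ)) j).indicator g x - g x) 2 volume) atTop
      (𝓝 0) := tendsto_eLpNorm_sub_of_lintegral' ha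
  -- `Hg ∈ L²`
  have hvfin : eLpNorm (hilbertTransform g) 2 volume < ⊤ := by
    have hev : ∀ᶠ j : ℕ in atTop, eLpNorm (fun x => hilbertTransform ((Icc (-(j : ℝ)) j).indicator g) x -
        hilbertTransform g x) 2 volume < 1 := (tendsto_order.1 hT).2 1 (by norm_num)
    obtain ⟨j, hj⟩ := hev.exists
    have heq : hilbertTransform g = fun x => hilbertTransform ((Icc (-(j : ℝ)) j).indicator g) x -
        (hilbertTransform ((Icc (-(j : ℝ)) j).indicator g) x - hilbertTransform g x) := by
      funext x; ring
    rw [heq]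
    refine lt_of_le_of_lt (eLpNorm_sub_le (f := fun x => hilbertTransform ((Icc (-(j : ℝ)) j).indicator g) x)
      (g := fun x => hilbertTransform ((Icc (-(j : ℝ)) j).indicator g) x - hilbertTransform g x)
      (hu j) ((hu j).sub hv) (by norm_num)) ?_
    exact ENNReal.add_lt_top.2 ⟨(hH j).1.eLpNorm_lt_top, hj.trans ENNReal.one_lt_top⟩
  -- `‖Hg_j‖₂ → ‖Hg‖₂`, `‖Hg_j‖₂ = ‖g_j‖₂ → ‖g‖₂`
  have hE := tendsto_eLpNorm_of_tendsto_sub' hu hv hvfin.ne hT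
  have hE' : Tendsto (fun j : ℕ => eLpNorm (hilbertTransform ((Icc (-(j : ℝ)) j).indicator g)) 2 volume) atTop
      (𝓝 (eLpNorm g 2 volume)) := by
    have h := tendsto_eLpNorm_of_tendsto_sub' (fun j => (hM2 j).1) hg2.1 hg2.eLpNorm_ne_top hTg
    refine h.congr fun j => ?_
    exact ((hH j).2).symm
  refine ⟨⟨hv, ?_⟩, tendsto_nhds_unique hE hE'⟩
  rw [tendsto_nhds_unique hE hE']
  exact hg2.eLpNorm_lt_top

/-- **Weighted isometry on the whole energy class**: for ODD real `f ∈ L¹ ∩ L²` with `x·f(x) ∈ L²` (i.e. `f ∈ L²((c+ξ²)dξ)`)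
whose symmetric p.v. integrand is integrable on `(0,∞)` at every point, and every real `c`:
`∫ (c + x²)(Hf x)² dx = ∫ (c + x²) f(x)² dx` (no `x·f ∈ L¹` hypothesis).
[cite: Grafakos2014, eq. (5.1.14)] [cite: King2009HilbertTransforms2, eq. (19.151)] -/
theorem integral_weight_mul_hilbertTransform_sq_eq_of_memLp {f : ℝ → ℝ} (hf : Integrable f)
    (hodd : ∀ y, f (-y) = -f y) (hf2 : MemLp f 2) (hxf2 : MemLp (fun y => y * f y) 2)
    (hint : ∀ x : ℝ, IntegrableOn (fun t => (f (x - t) - f (x + t)) / t) (Ioi 0)) (c : ℝ) :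
    MemLp (fun x => x * hilbertTransform f x) 2 ∧
      ∫ x, (c + x ^ 2) * (hilbertTransform f x) ^ 2 = ∫ x, (c + x ^ 2) * (f x) ^ 2 := by
  -- the p.v. integrand of `y f(y)` is integrable everywhere, and `H[y f] = x·Hf` pointwise
  have hint' : ∀ x : ℝ, IntegrableOn (fun t => ((x - t) * f (x - t) - (x + t) * f (x + t)) / t) (Ioi 0) :=
    fun x => integrableOn_symmIntegrand_id_mul hf (hint x)
  have hG := eLpNorm_hilbertTransform_eq_of_memLp hxf2 hint'
  have hpt : (fun x => x * hilbertTransform f x) = hilbertTransform (fun y => y * f y) := by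
    funext x; exact (hilbertTransform_mul_id_of_odd hf hodd (hint x)).symm
  have hxH : MemLp (fun x => x * hilbertTransform f x) 2 := by rw [hpt]; exact hG.1
  refine ⟨hxH, ?_⟩
  -- squares: `∫ (x Hf)² = ∫ (x f)²` from the `eLpNorm` identity
  have hsq : ∫ x, (x * hilbertTransform f x) ^ 2 = ∫ x, (x * f x) ^ 2 := by
    have h := hG.2
    rw [← hpt] at h
    rw [eLpNorm_eq_lintegral_rpow_enorm_toReal two_ne_zero ENNReal.ofNat_ne_top,
      eLpNorm_eq_lintegral_rpow_enorm_toReal two_ne_zero ENNReal.ofNat_ne_top] at h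
    simp only [ENNReal.toReal_ofNat, one_div, ENNReal.rpow_two] at h
    have h' : (∫⁻ x, ‖x * hilbertTransform f x‖ₑ ^ 2) = ∫⁻ x, ‖x * f x‖ₑ ^ 2 := by
      have h2 := congrArg (fun x : ℝ≥0∞ => x ^ (2 : ℝ)) h
      simp only [← ENNReal.rpow_mul, show (2 : ℝ)⁻¹ * 2 = 1 by norm_num, ENNReal.rpow_one] at h2
      exact h2
    rw [integral_eq_lintegral_of_nonneg_ae (ae_of_all _ fun x => sq_nonneg _)
        hxH.integrable_sq.aestronglyMeasurable,
      integral_eq_lintegral_of_nonneg_ae (ae_of_all _ fun x => sq_nonneg _)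
        hxf2.integrable_sq.aestronglyMeasurable]
    have e : ∀ (φ : ℝ → ℝ) (x : ℝ), ENNReal.ofReal (φ x ^ 2) = ‖φ x‖ₑ ^ 2 := fun φ x => by
      rw [← ofReal_norm, Real.norm_eq_abs, ← ENNReal.ofReal_pow (abs_nonneg _), sq_abs]
    simp_rw [e, h']
  have hH2 : Integrable (fun x => (hilbertTransform f x) ^ 2) :=
    (memLp_two_hilbertTransform hf hf2 (ae_of_all _ hint)).integrable_sq
  have hxH2 : Integrable (fun x => (x * hilbertTransform f x) ^ 2) := hxH.integrable_sq
  have hf2' : Integrable (fun x => (f x) ^ 2) := hf2.integrable_sq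
  have hxf2' : Integrable (fun x => (x * f x) ^ 2) := hxf2.integrable_sq
  have e1 : (fun x => (c + x ^ 2) * (hilbertTransform f x) ^ 2) =
      fun x => c * (hilbertTransform f x) ^ 2 + (x * hilbertTransform f x) ^ 2 := by
    funext x; ring
  have e2 : (fun x => (c + x ^ 2) * (f x) ^ 2) = fun x => c * (f x) ^ 2 + (x * f x) ^ 2 := by
    funext x; ring
  rw [e1, e2, integral_add (hH2.const_mul c) hxH2, integral_add (hf2'.const_mul c) hxf2', integral_const_mul,
    integral_const_mul, integral_hilbertTransform_sq_eq hf hf2 (ae_of_all _ hint), hsq]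

end Literature.Analysis.Fourier
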